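import Mathlib.Topology.Order.MonotoneContinuity
import Mathlib.Topology.Order.IntermediateValue
import Mathlib.Topology.Algebra.Order.Field
import Mathlib.Topology.Instances.Real.Lemmas
import Mathlib.Topology.Piecewise
import HarnessLib

/-!
# Extending an increasing homeomorphism of an interval to the whole line

Topic: chart bookkeeping (Topology / PlanarFoliations). A continuous strictly increasing function
on a compact interval `[u, v]` extends, by translations outside, to an **order isomorphism of
`ℝ`** (hence a homeomorphism):

* `extendIcc τ u v` (**definition**): `τ u + (x - u)` for `x ≤ u`, `τ x` on `[u, v]`,
  `τ v + (x - v)` for `v ≤ x`;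
* `strictMono_extendIcc`, `continuous_extendIcc`, `surjective_extendIcc` (**proved**);
* `orderIsoExtend` (**definition**) with `orderIsoExtend_apply_of_mem` (**proved**): the order
  isomorphism `ℝ ≃o ℝ` agreeing with `τ` on `[u, v]`.

Use: the height transitions between adjacent flow boxes of a foliation are increasing
homeomorphisms between height intervals; extended to `ℝ ≃o ℝ` they serve as the conversions
`σ` of the roof–floor edge charts (`TautFoliationsEdgeChart.lean`). All statements are [folklore].
-/

noncomputable section

open Set Filter Topology

namespace Literature.Topology.PlanarFoliations

variable {τ : ℝ → ℝ} {u v : ℝ}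

/-- **The extension by translations** of a function given on `[u, v]`. [folklore] -/
def extendIcc (τ : ℝ → ℝ) (u v x : ℝ) : ℝ :=
  if x ≤ u then τ u + (x - u) else if v ≤ x then τ v + (x - v) else τ x

/-- On `[u, v]` the extension is `τ`. [folklore] -/
theorem extendIcc_of_mem {x : ℝ} (hx : x ∈ Icc u v) : extendIcc τ u v x = τ x := by
  unfold extendIcc
  by_cases h1 : x ≤ u
  · have : x = u := le_antisymm h1 hx.1
    rw [if_pos h1, this, sub_self, add_zero]
  · rw [if_neg h1]
    by_cases h2 : v ≤ x
    · have : x = v := le_antisymm hx.2 h2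
      rw [if_pos h2, this, sub_self, add_zero]
    · rw [if_neg h2]

/-- Below `u` the extension is the translate. [folklore] -/
theorem extendIcc_of_le {x : ℝ} (hx : x ≤ u) : extendIcc τ u v x = τ u + (x - u) := if_pos hx

/-- Above `v` the extension is the translate (`u ≤ v`). [folklore] -/
theorem extendIcc_of_ge (huv : u ≤ v) {x : ℝ} (hx : v ≤ x) : extendIcc τ u v x = τ v + (x - v) := by
  unfold extendIcc
  by_cases h1 : x ≤ u
  · have hxu : x = u := le_antisymm h1 (huv.trans hx)
    have hvu : v = u := le_antisymm (hx.trans h1) huv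
    rw [if_pos h1, hxu, hvu]
  · rw [if_neg h1, if_pos hx]

/-- **The extension is strictly increasing** when `τ` is on `[u, v]`. [folklore] -/
theorem strictMono_extendIcc (huv : u ≤ v) (hτ : StrictMonoOn τ (Icc u v)) : StrictMono (extendIcc τ u v) := by
  have hmono : MonotoneOn τ (Icc u v) := hτ.monotoneOn
  have huv' : τ u ≤ τ v := hmono ⟨le_rfl, huv⟩ ⟨huv, le_rfl⟩ huv
  intro x y hxy
  -- compare through the three regions
  rcases le_or_gt x u with hxu | hxu
  · rw [extendIcc_of_le hxu]
    rcases le_or_gt y u with hyu | hyu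
    · rw [extendIcc_of_le hyu]; linarith
    rcases lt_or_ge y v with hyv | hyv
    · rw [extendIcc_of_mem ⟨hyu.le, hyv.le⟩]
      have : τ u < τ y := hτ ⟨le_rfl, huv⟩ ⟨hyu.le, hyv.le⟩ hyu
      linarith
    · rw [extendIcc_of_ge huv hyv]
      rcases eq_or_lt_of_le huv with h | h
      · subst h; linarith
      · have : τ u < τ v := hτ ⟨le_rfl, huv⟩ ⟨huv, le_rfl⟩ h
        linarith
  rcases lt_or_ge x v with hxv | hxv
  · rw [extendIcc_of_mem ⟨hxu.le, hxv.le⟩]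
    rcases lt_or_ge y v with hyv | hyv
    · rw [extendIcc_of_mem ⟨(hxu.trans hxy).le, hyv.le⟩]
      exact hτ ⟨hxu.le, hxv.le⟩ ⟨(hxu.trans hxy).le, hyv.le⟩ hxy
    · rw [extendIcc_of_ge huv hyv]
      have : τ x < τ v := hτ ⟨hxu.le, hxv.le⟩ ⟨huv, le_rfl⟩ hxv
      linarith
  · rw [extendIcc_of_ge huv hxv, extendIcc_of_ge huv (hxv.trans hxy.le)]; linarith

/-- **The extension is continuous** when `τ` is continuous on `[u, v]`. [folklore] -/
theorem continuous_extendIcc (huv : u ≤ v) (hτ : ContinuousOn τ (Icc u v)) : Continuous (extendIcc τ u v) := by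
  -- `extendIcc = (translate below u) glued with ((τ on [u,v]) glued with (translate above v))`
  have h1 : Continuous fun x : ℝ ↦ τ u + (x - u) := by fun_prop
  have h3 : Continuous fun x : ℝ ↦ τ v + (x - v) := by fun_prop
  -- inner glue at `v`: on `{x | u ≤ x}` use `τ` clamped
  have hinner : ContinuousOn (fun x ↦ if v ≤ x then τ v + (x - v) else τ x) (Ici u) := by
    refine ContinuousOn.if ?_ ?_ ?_
    · rintro x ⟨-, hx⟩
      have hxv : x = v := by
        have := frontier_le_subset_eq continuous_const continuous_id hx
        exact this.symm
      rw [hxv, sub_self, add_zero]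
    · exact h3.continuousOn
    · refine hτ.mono ?_
      rintro x ⟨hxu, hx⟩
      have hxv : x ≤ v := by
        have := closure_lt_subset_le continuous_id continuous_const (by simpa [not_le] using hx)
        exact this
      exact ⟨hxu, hxv⟩
  have hfull : Continuous fun x ↦ if x ≤ u then τ u + (x - u) else (if v ≤ x then τ v + (x - v) else τ x) := by
    refine continuous_if ?_ h1.continuousOn ?_
    · rintro x hx
      have hxu : x = u := frontier_le_subset_eq continuous_id continuous_const hx
      rw [hxu, sub_self, add_zero]
      by_cases hvu : v ≤ u
      · rw [if_pos hvu, show u = v from le_antisymm (hvu) huv ▸ rfl]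
        simp
      · rw [if_neg hvu]
    · refine hinner.mono ?_
      intro x hx
      have := closure_lt_subset_le continuous_const continuous_id (by simpa [not_le] using hx)
      exact this
  exact hfull

/-- **The extension is surjective** (continuous, tends to `±∞`). [folklore] -/
theorem surjective_extendIcc (huv : u ≤ v) (hτ : ContinuousOn τ (Icc u v)) :
    Function.Surjective (extendIcc τ u v) := by
  have hc := continuous_extendIcc huv hτ
  have htop : Tendsto (extendIcc τ u v) atTop atTop := by
    refine tendsto_atTop_atTop.2 fun b ↦ ⟨max v (b - τ v + v), fun x hx ↦ ?_⟩
    have hxv : v ≤ x := (le_max_left _ _).trans hx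
    rw [extendIcc_of_ge huv hxv]
    linarith [(le_max_right _ _).trans hx]
  have hbot : Tendsto (extendIcc τ u v) atBot atBot := by
    refine tendsto_atBot_atBot.2 fun b ↦ ⟨min u (b - τ u + u), fun x hx ↦ ?_⟩
    have hxu : x ≤ u := hx.trans (min_le_left _ _)
    rw [extendIcc_of_le hxu]
    linarith [hx.trans (min_le_right _ _)]
  exact hc.surjective htop hbot

/-- **The order isomorphism of `ℝ` extending `τ`.** [folklore] -/
def orderIsoExtend (τ : ℝ → ℝ) (u v : ℝ) (huv : u ≤ v) (hτ : ContinuousOn τ (Icc u v)) (hτm : StrictMonoOn τ (Icc u v)) :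
    ℝ ≃o ℝ :=
  StrictMono.orderIsoOfSurjective (extendIcc τ u v) (strictMono_extendIcc huv hτm) (surjective_extendIcc huv hτ)

/-- The extension order isomorphism agrees with `τ` on `[u, v]`. [folklore] -/
theorem orderIsoExtend_apply_of_mem (huv : u ≤ v) (hτ : ContinuousOn τ (Icc u v)) (hτm : StrictMonoOn τ (Icc u v)) {x : ℝ}
    (hx : x ∈ Icc u v) : orderIsoExtend τ u v huv hτ hτm x = τ x := by
  show extendIcc τ u v x = τ x
  exact extendIcc_of_mem hx

/-- The extension order isomorphism is `extendIcc`. [folklore] -/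
theorem orderIsoExtend_apply (huv : u ≤ v) (hτ : ContinuousOn τ (Icc u v)) (hτm : StrictMonoOn τ (Icc u v)) (x : ℝ) :
    orderIsoExtend τ u v huv hτ hτm x = extendIcc τ u v x := rfl

end Literature.Topology.PlanarFoliations
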